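import Summits.BirchSwinnertonDyer.Rank1Residual.Iwasawa.LambdaInvariantValuationTwisted
import Summits.BirchSwinnertonDyer.Rank1Residual.Supersingular.MazurTateLayerConsistency
import Summits.BirchSwinnertonDyer.Rank1Residual.Supersingular.SharpFlatRankZeroReal
import Summits.BirchSwinnertonDyer.Rank1Residual.Supersingular.MazurTateTwistedNonvanishingLayers
import HarnessLib

/-!
# Valuations of the cyclotomic twists at a supersingular prime: for Sprung's `(L♯, L♭)` (and
# Pollack's `L^±` at `a_p = 0`) EVERY primitive twist of conductor `p^{n+1+e₀}` has
# `v_p(∑_a χ(a)[a/p^{n+1+e₀}]⁺_f) = (q_n + λ^•)/φ(pⁿ)`-type valuation, and ONE twisted value of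
# valuation `< 1` CERTIFIES `μ(L^•) = 0` and `λ^•` — class X8 (`p = 3`, `a_3 = ±3`) included
# (cell `b2b-bsdres`, supersingular family, prover B = unit `b2b-bsdres-additive-p3`, gen 10; part 4/5)

HONEST FRAMING (run/shared/lean/b2b/bsd-rank1-residual/, verbatim in every file): the goal of the
cell is to DELETE the COMBINATION-SHAPED residual classes of the Birch–Swinnerton-Dyer formula for
ALL analytic-rank `≤ 1` elliptic curves over `ℚ` — "full BSD formula for every rank `≤ 1` curve in
class `C`" assembled STRICTLY from published theorems — so that the rank-`≤ 1` remainder becomes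
exactly the CONSTRUCTION-SHAPED classes, which are TYPED (missing-input `Prop`s), NOT attempted.
This is not "finishing BSD". THEOREMS ONLY (no definition, no named fact, no `sorry`); nothing about
any particular curve is asserted; nothing is booked; X8 / X7 / X6 stay CONSTRUCTION-SHAPED.

## What this file proves (parts 1–3: `Iwasawa/LambdaInvariantValuation{,Layer,Twisted}.lean`)

Part 3 proved, for any integral model `Θ` of `θ_{k+1}`: `|∑_a χ(a)[a/p^{k+1+e₀}]⁺_f| =
p^{−μ(Θ)}·|χ(γ) − 1|^{λ(Θ)}` when `λ(Θ) < φ(pᵏ⁺¹)`, and the ONE-VALUE CERTIFICATE. Here this is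
combined with the gen-4 reading `λ(θ_n) = deg ω_n^± + λ(L^•)`, for `p` odd, good supersingular
(`p ∣ a_p`), `f` the newform of `E = W`, and THE Sprung pair (exists p213581, unique p214240):

* §9 **`♯` (odd level `n = k+1`)**: `L♯ ≠ 0`, `μ(L♯) = 0`, `λ(L♯) + deg ω_n^+ < φ(pⁿ)` ⇒ for EVERY
  primitive even `p`-power-order `χ` of conductor `p^{n+e₀}`:
  **`|∑_a χ(a)[a/p^{n+e₀}]⁺_f|^{φ(pⁿ)} = p^{−(deg ω_n^+ + λ(L♯))}`**, i.e.
  `v_p(τ(χ̄)L(E,χ̄,1)/Ω⁺) = (q_n + λ♯)/φ(pⁿ)` (`norm_ratTwistedSymbolSum_pow_totient_eq_of_lam_sharp`);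
  `♭` at even levels with `deg ω_n^-` (`…_of_lam_flat`). No Mazur–Tate element has to be supplied:
  its integral model is produced inside the proof from the Sprung pair.
* §10 **THE ONE-VALUE CERTIFICATE FOR `(μ, λ)(L^•)`**: if ONE primitive even `p`-power-order `χ` of
  conductor `p^{n+e₀}`, `n` odd, has `|∑_a χ(a)[a/p^{n+e₀}]⁺_f| > 1/p`, then `μ(L♯) = 0` and
  `λ(L♯) + deg ω_n^+ = φ(pⁿ)·v_p(Birch(χ)) < φ(pⁿ)`
  (`mu_sharp_eq_zero_and_lam_sharp_add_eq_of_lt_norm`; `♭`/even: `mu_flat_…`) — ONE twisted value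
  of small valuation can serve as the census datum `hμ`, `hlam` of the rank-one squeezes.
* (`a_p = 0`, X6/X7: the same two statements for Pollack's `L_p^∓` in Kobayashi's labelling are
  in the sibling `Supersingular/SignedTwistedValuation.lean`.)
* §12 **Class X8** (`p = 3`, `a_3 = ±3`): the `♯/♭` statements ON THE CLASS
  (`X8.norm_ratTwistedSymbolSum_pow_totient_eq_of_lam_sharp/flat`, `X8.mu_sharp_…`, `X8.mu_flat_…`),
  and the TIGHT RANK-ONE READING: `λ♯ = 1`, `μ♯ = 0` ⇒ **every primitive cubic-power conductor-`9`
  twist has `|∑_a χ(a)[a/9]⁺_f|² = 1/3`**, i.e. `v_3 = 1/2` (`X8.norm_ratTwistedSymbolSum_sq_eq_of_lam_sharp_eq_one`;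
  nothing booked); conversely ONE conductor-`9` Birch sum of absolute value `> 1/3` certifies
  `μ♯ = 0 ∧ λ♯ ≤ 1` (`X8.mu_sharp_…` at `k = 0`).
* §13 **all layers at once**: `λ♯ ≤ p − 2` (resp. `λ♭ + p ≤ p(p−1)`) makes the hypothesis hold at
  EVERY odd (even) layer (gen 6's propagation), so `λ^•` determines `v_p` of EVERY cyclotomic twist of
  its parity (`…_of_lam_sharp_add_two_le`, `…_of_lam_flat_add_le`; X8: `λ♯ ≤ 1`, `λ♭ ≤ 3`).
Scope (honest): statements about the ANALYTIC side only (`θ_n`, `L♯`, `L♭`, Birch sums); they make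
the census certificates cheaper and cross-checkable but assert nothing about Selmer groups or BSD₃.

References: [Pollack2003] Prop. 6.9–6.10 (`λ(θ_n) = q_n + λ^±` ↔ valuations of twisted values);
[Sprung2017] §3, Cor. 3.6, Thm. 1.12; [MazurTateTeitelbaum1986Invent] §I.8; [Washington1997] §7.1–7.2;
[Kobayashi2003] (3.4)–(3.6). Memo: HOME/b2b-bsdres-additive-p3/X8-ROUTE-B.md §15 (gen 10).
-/

set_option autoImplicit false

noncomputable section

open scoped Classical MatrixGroups ModularForm

open CongruenceSubgroup Polynomial WeierstrassCurve Literature.NumberTheory.EllipticCurves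
  Literature.NumberTheory.EllipticCurves.ModularForms
  Literature.NumberTheory.EllipticCurves.Sprung2017
  Literature.NumberTheory.EllipticCurves.Rank1Residual
  Summit.BirchSwinnertonDyer.Rank1Residual.X1.MuLambda
  Summit.BirchSwinnertonDyer.Rank1Residual.Iwasawa

namespace Summit.BirchSwinnertonDyer.Rank1Residual.Supersingular

/-! ## §9. THE Sprung pair: valuations of all twists of a layer -/

section Sprung

variable {W : WeierstrassCurve ℚ} [W.IsElliptic] [W.IsGloballyMinimal] {N : ℕ} [NeZero N]
  {f : CuspForm (Gamma0 N) 2} {p : ℕ} [hp : Fact p.Prime]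

/-- **Valuation of the twists, colour `♯` (odd level).** `p ≠ 2` good supersingular, `f` the newform
of `E = W`, `(L♯, L♭)` ANY Sprung pair (= THE pair), `L♯ ≠ 0`, `μ(L♯) = 0`, `n = k + 1` odd with
`λ(L♯) + deg ω_n^+ < φ(pⁿ)`. Then for EVERY primitive even `p`-power-order `χ` mod `p^{n+e₀}` with
values in `ℂ_p`: `|∑_a χ(a)[a/p^{n+e₀}]⁺_f|^{φ(pⁿ)} = p^{−(deg ω_n^+ + λ(L♯))}`.
[cite: Pollack2003, Prop. 6.9 and Prop. 6.10] [cite: Sprung2017, §3, Cor. 3.6 and Thm. 1.12]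
[cite: Washington1997, §7.1–7.2 and Thm. 7.3] -/
theorem norm_ratTwistedSymbolSum_pow_totient_eq_of_lam_sharp (hp2 : p ≠ 2) (hf : IsNewformOf W f)
    (hgood : W.HasGoodReductionAtPrime p) (hap : (p : ℤ) ∣ W.frobeniusTrace p)
    {Lsharp Lflat : IwasawaAlgebra p} (hSP : IsSprungPair f p (W.frobeniusTrace p) Lsharp Lflat)
    (hL0 : Lsharp ≠ 0) (hμL : mu Lsharp = 0) {k : ℕ} (hn : Odd (k + 1))
    (hlt : lam Lsharp + (cyclotomicOmegaPlus p (k + 1)).natDegree < Nat.totient (p ^ (k + 1)))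
    (χ : DirichletCharacter ℂ_[p] (p ^ (k + 1 + cyclotomicExponent p))) (hχ : χ.IsPrimitive)
    (hev : χ.Even) (hord : ∃ j : ℕ, orderOf χ = p ^ j) :
    ‖ratTwistedSymbolSum f χ‖ ^ Nat.totient (p ^ (k + 1)) =
      ((p : ℝ)⁻¹) ^ ((cyclotomicOmegaPlus p (k + 1)).natDegree + lam Lsharp) := by
  obtain ⟨Q, hQ⟩ := exists_integral_mazurTate_of_isSprungPair hp2 hf hgood hap hSP (k + 1)
  have hlt' : lam Lsharp + (cyclotomicOmegaPlus p (k + 1)).natDegree < p ^ (k + 1) :=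
    lt_of_lt_of_le hlt (Nat.totient_le _)
  obtain ⟨hΘ0, hμΘ, hlamΘ⟩ := lam_mazurTate_eq_of_lam_sharp hp2 hf hgood hap hSP hL0 hμL hn hlt' hQ.symm
  have hlamlt : lam (toIwasawa p (cyclotomicOmega p (k + 1)) * Q -
      (toIwasawa p (sharpPoly (W.frobeniusTrace p) p (k + 1)) * Lsharp +
        toIwasawa p (flatPoly (W.frobeniusTrace p) p (k + 1)) * Lflat)) <
      Nat.totient (p ^ (k + 1)) := by rw [hlamΘ]; omega
  rw [mazurTate_norm_ratTwistedSymbolSum_pow_totient_eq_of_lam_lt_totient hQ.symm hΘ0 χ hχ hev hord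
    hlamlt, hμΘ, hlamΘ, mul_zero, zero_add, add_comm]

/-- **Valuation of the twists, colour `♭` (even level `n = k + 1 ≥ 2`)**: with `L♭ ≠ 0`,
`μ(L♭) = 0`, `λ(L♭) + deg ω_n^- < φ(pⁿ)`: `|∑_a χ(a)[a/p^{n+e₀}]⁺_f|^{φ(pⁿ)} = p^{−(deg ω_n^- + λ(L♭))}`.
[cite: Pollack2003, Prop. 6.9 and Prop. 6.10] [cite: Sprung2017, §3, Cor. 3.6 and Thm. 1.12]
[cite: Washington1997, §7.1–7.2 and Thm. 7.3] -/
theorem norm_ratTwistedSymbolSum_pow_totient_eq_of_lam_flat (hp2 : p ≠ 2) (hf : IsNewformOf W f)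
    (hgood : W.HasGoodReductionAtPrime p) (hap : (p : ℤ) ∣ W.frobeniusTrace p)
    {Lsharp Lflat : IwasawaAlgebra p} (hSP : IsSprungPair f p (W.frobeniusTrace p) Lsharp Lflat)
    (hL0 : Lflat ≠ 0) (hμL : mu Lflat = 0) {k : ℕ} (hn : Even (k + 1))
    (hlt : lam Lflat + (cyclotomicOmegaMinus p (k + 1)).natDegree < Nat.totient (p ^ (k + 1)))
    (χ : DirichletCharacter ℂ_[p] (p ^ (k + 1 + cyclotomicExponent p))) (hχ : χ.IsPrimitive)
    (hev : χ.Even) (hord : ∃ j : ℕ, orderOf χ = p ^ j) :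
    ‖ratTwistedSymbolSum f χ‖ ^ Nat.totient (p ^ (k + 1)) =
      ((p : ℝ)⁻¹) ^ ((cyclotomicOmegaMinus p (k + 1)).natDegree + lam Lflat) := by
  obtain ⟨Q, hQ⟩ := exists_integral_mazurTate_of_isSprungPair hp2 hf hgood hap hSP (k + 1)
  have hlt' : lam Lflat + (cyclotomicOmegaMinus p (k + 1)).natDegree < p ^ (k + 1) :=
    lt_of_lt_of_le hlt (Nat.totient_le _)
  obtain ⟨hΘ0, hμΘ, hlamΘ⟩ := lam_mazurTate_eq_of_lam_flat hp2 hf hgood hap hSP hL0 hμL hn hlt' hQ.symm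
  have hlamlt : lam (toIwasawa p (cyclotomicOmega p (k + 1)) * Q -
      (toIwasawa p (sharpPoly (W.frobeniusTrace p) p (k + 1)) * Lsharp +
        toIwasawa p (flatPoly (W.frobeniusTrace p) p (k + 1)) * Lflat)) <
      Nat.totient (p ^ (k + 1)) := by rw [hlamΘ]; omega
  rw [mazurTate_norm_ratTwistedSymbolSum_pow_totient_eq_of_lam_lt_totient hQ.symm hΘ0 χ hχ hev hord
    hlamlt, hμΘ, hlamΘ, mul_zero, zero_add, add_comm]

end Sprung

/-! ## §10. ONE twisted value certifies `(μ, λ)(L^•)` -/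

section Certificate

variable {W : WeierstrassCurve ℚ} [W.IsElliptic] [W.IsGloballyMinimal] {N : ℕ} [NeZero N]
  {f : CuspForm (Gamma0 N) 2} {p : ℕ} [hp : Fact p.Prime]

omit [W.IsElliptic] [W.IsGloballyMinimal] [NeZero N] in
/-- An integral model `Θ` of `θ_{k+1}` one of whose Birch sums has absolute value `> 1/p` is
non-zero (a zero model has all Birch sums `0`). [cite: MazurTateTeitelbaum1986Invent, §I.8] -/
theorem mazurTate_model_ne_zero_of_lt_norm {k : ℕ} {Θ : IwasawaAlgebra p}
    (hΘ : iwasawaToPowerSeries p Θ =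
      ((mazurTateElement f p (k + 1)).map (algebraMap ℚ ℚ_[p]) : PowerSeries ℚ_[p]))
    (χ : DirichletCharacter ℂ_[p] (p ^ (k + 1 + cyclotomicExponent p))) (hev : χ.Even)
    (hord : ∃ j : ℕ, orderOf χ = p ^ j) (h : (p : ℝ)⁻¹ < ‖ratTwistedSymbolSum f χ‖) : Θ ≠ 0 := by
  rintro rfl
  have hsum := hasSum_mazurTate_eq_ratTwistedSymbolSum hΘ χ hev hord
  simp only [map_zero, zero_mul] at hsum
  rw [← hasSum_zero.unique hsum, norm_zero] at h
  exact absurd h (not_lt.mpr (inv_nonneg.mpr (Nat.cast_nonneg _)))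

/-- **ONE-VALUE CERTIFICATE for `L♯`.** `p ≠ 2` good supersingular, `f` the newform, ANY Sprung
pair, `n = k + 1` odd. If ONE primitive even `p`-power-order `χ` mod `p^{n+e₀}` has
`|∑_a χ(a)[a/p^{n+e₀}]⁺_f| > 1/p`, then `μ(L♯) = 0`, `λ(L♯) + deg ω_n^+ < φ(pⁿ)` and
`|Birch(χ)|^{φ(pⁿ)} = p^{−(λ(L♯) + deg ω_n^+)}` — i.e. `λ♯ = φ(pⁿ)·v_p(Birch(χ)) − q_n`.
[cite: Pollack2003, Prop. 6.9 and Prop. 6.10] [cite: Sprung2017, §3, Cor. 3.6 and Thm. 1.12]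
[cite: Washington1997, §7.1–7.2 and Thm. 7.3] -/
theorem mu_sharp_eq_zero_and_lam_sharp_add_eq_of_lt_norm (hp2 : p ≠ 2) (hf : IsNewformOf W f)
    (hgood : W.HasGoodReductionAtPrime p) (hap : (p : ℤ) ∣ W.frobeniusTrace p)
    {Lsharp Lflat : IwasawaAlgebra p} (hSP : IsSprungPair f p (W.frobeniusTrace p) Lsharp Lflat)
    {k : ℕ} (hn : Odd (k + 1)) (χ : DirichletCharacter ℂ_[p] (p ^ (k + 1 + cyclotomicExponent p)))
    (hχ : χ.IsPrimitive) (hev : χ.Even) (hord : ∃ j : ℕ, orderOf χ = p ^ j)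
    (h : (p : ℝ)⁻¹ < ‖ratTwistedSymbolSum f χ‖) :
    mu Lsharp = 0 ∧ lam Lsharp + (cyclotomicOmegaPlus p (k + 1)).natDegree < Nat.totient (p ^ (k + 1)) ∧
      ‖ratTwistedSymbolSum f χ‖ ^ Nat.totient (p ^ (k + 1)) =
        ((p : ℝ)⁻¹) ^ (lam Lsharp + (cyclotomicOmegaPlus p (k + 1)).natDegree) := by
  obtain ⟨Q, hQ⟩ := exists_integral_mazurTate_of_isSprungPair hp2 hf hgood hap hSP (k + 1)
  set Θ := toIwasawa p (cyclotomicOmega p (k + 1)) * Q -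
      (toIwasawa p (sharpPoly (W.frobeniusTrace p) p (k + 1)) * Lsharp +
        toIwasawa p (flatPoly (W.frobeniusTrace p) p (k + 1)) * Lflat) with hΘdef
  have hΘ0 : Θ ≠ 0 := mazurTate_model_ne_zero_of_lt_norm hQ.symm χ hev hord h
  obtain ⟨hμΘ, hlamΘ, hpow⟩ :=
    mazurTate_mu_eq_zero_and_lam_lt_totient_of_lt_norm hQ.symm hΘ0 χ hχ hev hord h
  have hltp : lam Θ < p ^ (k + 1) := lt_of_lt_of_le hlamΘ (Nat.totient_le _)
  obtain ⟨hμA, hlamA⟩ := mu_eq_zero_and_lam_add_eq_of_odd hap hn hΘdef hΘ0 hμΘ hltp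
  exact ⟨hμA, by rw [hlamA]; exact hlamΘ, by rw [hlamA]; exact hpow⟩

/-- **ONE-VALUE CERTIFICATE for `L♭`** (even level `n = k + 1`): ONE `χ` mod `p^{n+e₀}` with
`|Birch(χ)| > 1/p` gives `μ(L♭) = 0`, `λ(L♭) + deg ω_n^- < φ(pⁿ)`,
`|Birch(χ)|^{φ(pⁿ)} = p^{−(λ(L♭) + deg ω_n^-)}`. [cite: Pollack2003, Prop. 6.9 and Prop. 6.10]
[cite: Sprung2017, §3, Cor. 3.6 and Thm. 1.12] [cite: Washington1997, §7.1–7.2 and Thm. 7.3] -/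
theorem mu_flat_eq_zero_and_lam_flat_add_eq_of_lt_norm (hp2 : p ≠ 2) (hf : IsNewformOf W f)
    (hgood : W.HasGoodReductionAtPrime p) (hap : (p : ℤ) ∣ W.frobeniusTrace p)
    {Lsharp Lflat : IwasawaAlgebra p} (hSP : IsSprungPair f p (W.frobeniusTrace p) Lsharp Lflat)
    {k : ℕ} (hn : Even (k + 1)) (χ : DirichletCharacter ℂ_[p] (p ^ (k + 1 + cyclotomicExponent p)))
    (hχ : χ.IsPrimitive) (hev : χ.Even) (hord : ∃ j : ℕ, orderOf χ = p ^ j)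
    (h : (p : ℝ)⁻¹ < ‖ratTwistedSymbolSum f χ‖) :
    mu Lflat = 0 ∧ lam Lflat + (cyclotomicOmegaMinus p (k + 1)).natDegree < Nat.totient (p ^ (k + 1)) ∧
      ‖ratTwistedSymbolSum f χ‖ ^ Nat.totient (p ^ (k + 1)) =
        ((p : ℝ)⁻¹) ^ (lam Lflat + (cyclotomicOmegaMinus p (k + 1)).natDegree) := by
  obtain ⟨Q, hQ⟩ := exists_integral_mazurTate_of_isSprungPair hp2 hf hgood hap hSP (k + 1)
  set Θ := toIwasawa p (cyclotomicOmega p (k + 1)) * Q -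
      (toIwasawa p (sharpPoly (W.frobeniusTrace p) p (k + 1)) * Lsharp +
        toIwasawa p (flatPoly (W.frobeniusTrace p) p (k + 1)) * Lflat) with hΘdef
  have hΘ0 : Θ ≠ 0 := mazurTate_model_ne_zero_of_lt_norm hQ.symm χ hev hord h
  obtain ⟨hμΘ, hlamΘ, hpow⟩ :=
    mazurTate_mu_eq_zero_and_lam_lt_totient_of_lt_norm hQ.symm hΘ0 χ hχ hev hord h
  have hltp : lam Θ < p ^ (k + 1) := lt_of_lt_of_le hlamΘ (Nat.totient_le _)
  obtain ⟨hμB, hlamB⟩ := mu_eq_zero_and_lam_add_eq_of_even hap hn hΘdef hΘ0 hμΘ hltp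
  exact ⟨hμB, by rw [hlamB]; exact hlamΘ, by rw [hlamB]; exact hpow⟩

end Certificate

/-! ## §12. Class X8 (`p = 3`, `a_3 = ±3`) and the tight rank-one reading -/

section X8

variable {W : WeierstrassCurve ℚ} [W.IsElliptic] [W.IsGloballyMinimal] {N : ℕ} [NeZero N]
  {f : CuspForm (Gamma0 N) 2} {p : ℕ} [hp : Fact p.Prime]

/-- **X8, colour `♯`**: for an X8 pair, `f` the newform, THE Sprung pair with `L♯ ≠ 0`, `μ(L♯) = 0`,
`n = k+1` odd, `λ(L♯) + deg ω_n^+ < φ(3ⁿ)`: every primitive even `3`-power-order `χ` mod `3^{n+1}`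
has `|∑_a χ(a)[a/3^{n+1}]⁺_f|^{φ(3ⁿ)} = 3^{−(deg ω_n^+ + λ♯)}`.
[cite: Sprung2017, §3, Cor. 3.6 and Thm. 1.12] [cite: Pollack2003, Prop. 6.9 and Prop. 6.10] -/
theorem X8.norm_ratTwistedSymbolSum_pow_totient_eq_of_lam_sharp (hX : ClassX8 W p)
    (hf : IsNewformOf W f) {Lsharp Lflat : IwasawaAlgebra p}
    (hSP : IsSprungPair f p (W.frobeniusTrace p) Lsharp Lflat) (hL0 : Lsharp ≠ 0)
    (hμL : mu Lsharp = 0) {k : ℕ} (hn : Odd (k + 1))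
    (hlt : lam Lsharp + (cyclotomicOmegaPlus p (k + 1)).natDegree < Nat.totient (p ^ (k + 1)))
    (χ : DirichletCharacter ℂ_[p] (p ^ (k + 1 + cyclotomicExponent p))) (hχ : χ.IsPrimitive)
    (hev : χ.Even) (hord : ∃ j : ℕ, orderOf χ = p ^ j) :
    ‖ratTwistedSymbolSum f χ‖ ^ Nat.totient (p ^ (k + 1)) =
      ((p : ℝ)⁻¹) ^ ((cyclotomicOmegaPlus p (k + 1)).natDegree + lam Lsharp) := by
  obtain ⟨rfl, ⟨hgood, hap⟩, -⟩ := hX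
  exact norm_ratTwistedSymbolSum_pow_totient_eq_of_lam_sharp (by decide) hf hgood hap hSP hL0 hμL hn
    hlt χ hχ hev hord

/-- **X8, colour `♭`** (even `n = k+1`, `deg ω_n^-`). [cite: Sprung2017, §3, Cor. 3.6 and Thm. 1.12]
[cite: Pollack2003, Prop. 6.9 and Prop. 6.10] -/
theorem X8.norm_ratTwistedSymbolSum_pow_totient_eq_of_lam_flat (hX : ClassX8 W p)
    (hf : IsNewformOf W f) {Lsharp Lflat : IwasawaAlgebra p}
    (hSP : IsSprungPair f p (W.frobeniusTrace p) Lsharp Lflat) (hL0 : Lflat ≠ 0)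
    (hμL : mu Lflat = 0) {k : ℕ} (hn : Even (k + 1))
    (hlt : lam Lflat + (cyclotomicOmegaMinus p (k + 1)).natDegree < Nat.totient (p ^ (k + 1)))
    (χ : DirichletCharacter ℂ_[p] (p ^ (k + 1 + cyclotomicExponent p))) (hχ : χ.IsPrimitive)
    (hev : χ.Even) (hord : ∃ j : ℕ, orderOf χ = p ^ j) :
    ‖ratTwistedSymbolSum f χ‖ ^ Nat.totient (p ^ (k + 1)) =
      ((p : ℝ)⁻¹) ^ ((cyclotomicOmegaMinus p (k + 1)).natDegree + lam Lflat) := by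
  obtain ⟨rfl, ⟨hgood, hap⟩, -⟩ := hX
  exact norm_ratTwistedSymbolSum_pow_totient_eq_of_lam_flat (by decide) hf hgood hap hSP hL0 hμL hn
    hlt χ hχ hev hord

/-- **X8: ONE conductor-`3^{n+1}` Birch sum with `|·| > 1/3` certifies `(μ, λ)(L♯)`** (`n` odd):
`μ♯ = 0`, `λ♯ + deg ω_n^+ < φ(3ⁿ)`, `|Birch(χ)|^{φ(3ⁿ)} = 3^{−(λ♯ + deg ω_n^+)}`.
[cite: Sprung2017, §3, Cor. 3.6 and Thm. 1.12] [cite: Pollack2003, Prop. 6.9 and Prop. 6.10] -/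
theorem X8.mu_sharp_eq_zero_and_lam_sharp_add_eq_of_lt_norm (hX : ClassX8 W p)
    (hf : IsNewformOf W f) {Lsharp Lflat : IwasawaAlgebra p}
    (hSP : IsSprungPair f p (W.frobeniusTrace p) Lsharp Lflat) {k : ℕ} (hn : Odd (k + 1))
    (χ : DirichletCharacter ℂ_[p] (p ^ (k + 1 + cyclotomicExponent p))) (hχ : χ.IsPrimitive)
    (hev : χ.Even) (hord : ∃ j : ℕ, orderOf χ = p ^ j) (h : (p : ℝ)⁻¹ < ‖ratTwistedSymbolSum f χ‖) :
    mu Lsharp = 0 ∧ lam Lsharp + (cyclotomicOmegaPlus p (k + 1)).natDegree < Nat.totient (p ^ (k + 1)) ∧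
      ‖ratTwistedSymbolSum f χ‖ ^ Nat.totient (p ^ (k + 1)) =
        ((p : ℝ)⁻¹) ^ (lam Lsharp + (cyclotomicOmegaPlus p (k + 1)).natDegree) := by
  obtain ⟨rfl, ⟨hgood, hap⟩, -⟩ := hX
  exact mu_sharp_eq_zero_and_lam_sharp_add_eq_of_lt_norm (by decide) hf hgood hap hSP hn χ hχ hev hord h

/-- **X8: ONE-VALUE CERTIFICATE for `(μ, λ)(L♭)`** (even `n = k+1`).
[cite: Sprung2017, §3, Cor. 3.6 and Thm. 1.12] [cite: Pollack2003, Prop. 6.9 and Prop. 6.10] -/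
theorem X8.mu_flat_eq_zero_and_lam_flat_add_eq_of_lt_norm (hX : ClassX8 W p)
    (hf : IsNewformOf W f) {Lsharp Lflat : IwasawaAlgebra p}
    (hSP : IsSprungPair f p (W.frobeniusTrace p) Lsharp Lflat) {k : ℕ} (hn : Even (k + 1))
    (χ : DirichletCharacter ℂ_[p] (p ^ (k + 1 + cyclotomicExponent p))) (hχ : χ.IsPrimitive)
    (hev : χ.Even) (hord : ∃ j : ℕ, orderOf χ = p ^ j) (h : (p : ℝ)⁻¹ < ‖ratTwistedSymbolSum f χ‖) :
    mu Lflat = 0 ∧ lam Lflat + (cyclotomicOmegaMinus p (k + 1)).natDegree < Nat.totient (p ^ (k + 1)) ∧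
      ‖ratTwistedSymbolSum f χ‖ ^ Nat.totient (p ^ (k + 1)) =
        ((p : ℝ)⁻¹) ^ (lam Lflat + (cyclotomicOmegaMinus p (k + 1)).natDegree) := by
  obtain ⟨rfl, ⟨hgood, hap⟩, -⟩ := hX
  exact mu_flat_eq_zero_and_lam_flat_add_eq_of_lt_norm (by decide) hf hgood hap hSP hn χ hχ hev hord h

omit hp in
/-- `deg ω_1^+ = 0` (empty product). [cite: Pollack2003, §6.5 (display before Prop. 6.18)] -/
theorem natDegree_cyclotomicOmegaPlus_one : (cyclotomicOmegaPlus p 1).natDegree = 0 := by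
  simp [cyclotomicOmegaPlus]

/-- **X8, THE TIGHT RANK-ONE READING (`λ♯ = 1`).** For an X8 pair whose Sprung `L♯` has
`μ(L♯) = 0`, `λ(L♯) = 1` (the census certificate of the 25 tight window pairs; at `ord_{s=1}L = 1`
the value `1` is forced minimal by parity, gen 5): EVERY primitive even `3`-power-order `χ` of
conductor `9` (`= 3^{0+1+e₀}`) has **`|∑_a χ(a)[a/9]⁺_f|² = 1/3`**, i.e.
`v_3(τ(χ̄)L(E, χ̄, 1)/Ω⁺_E) = 1/2` (layer `n = 1`: `deg ω_1^+ = 0`, `φ(3) = 2`).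
[cite: Sprung2017, §3, Cor. 3.6 and Thm. 1.12] [cite: Pollack2003, Prop. 6.9 and Prop. 6.10] -/
theorem X8.norm_ratTwistedSymbolSum_sq_eq_of_lam_sharp_eq_one (hX : ClassX8 W p)
    (hf : IsNewformOf W f) {Lsharp Lflat : IwasawaAlgebra p}
    (hSP : IsSprungPair f p (W.frobeniusTrace p) Lsharp Lflat) (hμL : mu Lsharp = 0)
    (hlam : lam Lsharp = 1) (χ : DirichletCharacter ℂ_[p] (p ^ (0 + 1 + cyclotomicExponent p)))
    (hχ : χ.IsPrimitive) (hev : χ.Even) (hord : ∃ j : ℕ, orderOf χ = p ^ j) :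
    ‖ratTwistedSymbolSum f χ‖ ^ 2 = (3 : ℝ)⁻¹ := by
  have hX' := hX
  obtain ⟨rfl, -, -⟩ := hX'
  have hL0 : Lsharp ≠ 0 := by
    rintro rfl
    have h0 : lam (0 : IwasawaAlgebra 3) = 0 := by simp [lam, pfree]
    omega
  have hφ : Nat.totient (3 ^ (0 + 1)) = 2 := by rw [Nat.zero_add, pow_one, Nat.totient_prime hp.out]
  have hdeg : (cyclotomicOmegaPlus 3 (0 + 1)).natDegree = 0 := by
    rw [Nat.zero_add, natDegree_cyclotomicOmegaPlus_one]
  have hlt : lam Lsharp + (cyclotomicOmegaPlus 3 (0 + 1)).natDegree < Nat.totient (3 ^ (0 + 1)) := by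
    rw [hdeg, hφ, hlam]
    norm_num
  have h := X8.norm_ratTwistedSymbolSum_pow_totient_eq_of_lam_sharp hX hf hSP hL0 hμL (k := 0)
    (by decide) hlt χ hχ hev hord
  rw [hφ, hdeg, hlam] at h
  simpa using h

end X8

/-! ## §13. All layers at once: small `λ^•` determines the valuation of EVERY twist of its parity -/

section AllLayers

variable {W : WeierstrassCurve ℚ} [W.IsElliptic] [W.IsGloballyMinimal] {N : ℕ} [NeZero N]
  {f : CuspForm (Gamma0 N) 2} {p : ℕ} [hp : Fact p.Prime]

/-- **ALL ODD LAYERS, colour `♯`.** `p ≠ 2` good supersingular, THE Sprung pair, `L♯ ≠ 0`,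
`μ(L♯) = 0`, **`λ(L♯) ≤ p − 2`** (then `λ♯ + deg ω_n^+ < φ(pⁿ)` at EVERY odd `n`, gen 6's propagation
`add_natDegree_cyclotomicOmegaPlus_lt_totient`): for every odd `n = k + 1` and every primitive even
`p`-power-order `χ` mod `p^{n+e₀}`, `|∑_a χ(a)[a/p^{n+e₀}]⁺_f|^{φ(pⁿ)} = p^{−(deg ω_n^+ + λ♯)}` — the
`p`-adic valuation of EVERY cyclotomic twist of odd layer is determined by `λ♯`.
[cite: Pollack2003, Prop. 6.9 and Prop. 6.10] [cite: Sprung2017, §3, Cor. 3.6 and Thm. 1.12] -/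
theorem norm_ratTwistedSymbolSum_pow_totient_eq_of_lam_sharp_add_two_le (hp2 : p ≠ 2)
    (hf : IsNewformOf W f) (hgood : W.HasGoodReductionAtPrime p) (hap : (p : ℤ) ∣ W.frobeniusTrace p)
    {Lsharp Lflat : IwasawaAlgebra p} (hSP : IsSprungPair f p (W.frobeniusTrace p) Lsharp Lflat)
    (hL0 : Lsharp ≠ 0) (hμL : mu Lsharp = 0) (hsmall : lam Lsharp + 2 ≤ p) {k : ℕ} (hn : Odd (k + 1))
    (χ : DirichletCharacter ℂ_[p] (p ^ (k + 1 + cyclotomicExponent p))) (hχ : χ.IsPrimitive)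
    (hev : χ.Even) (hord : ∃ j : ℕ, orderOf χ = p ^ j) :
    ‖ratTwistedSymbolSum f χ‖ ^ Nat.totient (p ^ (k + 1)) =
      ((p : ℝ)⁻¹) ^ ((cyclotomicOmegaPlus p (k + 1)).natDegree + lam Lsharp) :=
  norm_ratTwistedSymbolSum_pow_totient_eq_of_lam_sharp hp2 hf hgood hap hSP hL0 hμL hn
    (add_natDegree_cyclotomicOmegaPlus_lt_totient (p := p) hsmall hn) χ hχ hev hord

/-- **ALL EVEN LAYERS `n ≥ 2`, colour `♭`**: with `L♭ ≠ 0`, `μ(L♭) = 0`, **`λ(L♭) + p ≤ p(p − 1)`**: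
`|∑_a χ(a)[a/p^{n+e₀}]⁺_f|^{φ(pⁿ)} = p^{−(deg ω_n^- + λ♭)}` for every even `n = k + 1` and every primitive
even `p`-power-order `χ` mod `p^{n+e₀}`. [cite: Pollack2003, Prop. 6.9 and Prop. 6.10]
[cite: Sprung2017, §3, Cor. 3.6 and Thm. 1.12] -/
theorem norm_ratTwistedSymbolSum_pow_totient_eq_of_lam_flat_add_le (hp2 : p ≠ 2)
    (hf : IsNewformOf W f) (hgood : W.HasGoodReductionAtPrime p) (hap : (p : ℤ) ∣ W.frobeniusTrace p)
    {Lsharp Lflat : IwasawaAlgebra p} (hSP : IsSprungPair f p (W.frobeniusTrace p) Lsharp Lflat)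
    (hL0 : Lflat ≠ 0) (hμL : mu Lflat = 0) (hsmall : lam Lflat + p ≤ p * (p - 1)) {k : ℕ}
    (hn : Even (k + 1)) (χ : DirichletCharacter ℂ_[p] (p ^ (k + 1 + cyclotomicExponent p)))
    (hχ : χ.IsPrimitive) (hev : χ.Even) (hord : ∃ j : ℕ, orderOf χ = p ^ j) :
    ‖ratTwistedSymbolSum f χ‖ ^ Nat.totient (p ^ (k + 1)) =
      ((p : ℝ)⁻¹) ^ ((cyclotomicOmegaMinus p (k + 1)).natDegree + lam Lflat) :=
  norm_ratTwistedSymbolSum_pow_totient_eq_of_lam_flat hp2 hf hgood hap hSP hL0 hμL hn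
    (add_natDegree_cyclotomicOmegaMinus_lt_totient (p := p) hsmall hn (Nat.succ_pos k)) χ hχ hev hord

/-- **X8, all odd layers**: on ClassX8 with `L♯ ≠ 0`, `μ♯ = 0`, **`λ♯ ≤ 1`** (the tight value `1`
at analytic rank one; `0` in the unit rank-zero case): for every odd `n = k+1` and every primitive
even `3`-power-order `χ` of conductor `3^{n+1}`, `|∑_a χ(a)[a/3^{n+1}]⁺_f|^{φ(3ⁿ)} = 3^{−(deg ω_n^+ + λ♯)}`
— e.g. `λ♯ = 1`: `v_3 = 1/2, 7/18, 61/162, …` at conductors `9, 81, 729, …`.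
[cite: Sprung2017, §3, Cor. 3.6 and Thm. 1.12] [cite: Pollack2003, Prop. 6.9 and Prop. 6.10] -/
theorem X8.norm_ratTwistedSymbolSum_pow_totient_eq_of_lam_sharp_le_one (hX : ClassX8 W p)
    (hf : IsNewformOf W f) {Lsharp Lflat : IwasawaAlgebra p}
    (hSP : IsSprungPair f p (W.frobeniusTrace p) Lsharp Lflat) (hL0 : Lsharp ≠ 0)
    (hμL : mu Lsharp = 0) (hlam : lam Lsharp ≤ 1) {k : ℕ} (hn : Odd (k + 1))
    (χ : DirichletCharacter ℂ_[p] (p ^ (k + 1 + cyclotomicExponent p))) (hχ : χ.IsPrimitive)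
    (hev : χ.Even) (hord : ∃ j : ℕ, orderOf χ = p ^ j) :
    ‖ratTwistedSymbolSum f χ‖ ^ Nat.totient (p ^ (k + 1)) =
      ((p : ℝ)⁻¹) ^ ((cyclotomicOmegaPlus p (k + 1)).natDegree + lam Lsharp) := by
  obtain ⟨rfl, ⟨hgood, hap⟩, -⟩ := hX
  exact norm_ratTwistedSymbolSum_pow_totient_eq_of_lam_sharp_add_two_le (by decide) hf hgood hap hSP
    hL0 hμL (by omega) hn χ hχ hev hord

/-- **X8, all even layers `n ≥ 2`**: with `L♭ ≠ 0`, `μ♭ = 0`, **`λ♭ ≤ 3`**: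
`|∑_a χ(a)[a/3^{n+1}]⁺_f|^{φ(3ⁿ)} = 3^{−(deg ω_n^- + λ♭)}` for every even `n = k+1` and every primitive
even `3`-power-order `χ` of conductor `3^{n+1}` — e.g. `λ♭ = 1`: `v_3 = 1/2` at conductor `27`
(`deg ω_2^- = 2`, `φ(9) = 6`); `λ♭ = 3`: `v_3 = 5/6`. [cite: Sprung2017, §3, Cor. 3.6 and Thm. 1.12]
[cite: Pollack2003, Prop. 6.9 and Prop. 6.10] -/
theorem X8.norm_ratTwistedSymbolSum_pow_totient_eq_of_lam_flat_le_three (hX : ClassX8 W p)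
    (hf : IsNewformOf W f) {Lsharp Lflat : IwasawaAlgebra p}
    (hSP : IsSprungPair f p (W.frobeniusTrace p) Lsharp Lflat) (hL0 : Lflat ≠ 0)
    (hμL : mu Lflat = 0) (hlam : lam Lflat ≤ 3) {k : ℕ} (hn : Even (k + 1))
    (χ : DirichletCharacter ℂ_[p] (p ^ (k + 1 + cyclotomicExponent p))) (hχ : χ.IsPrimitive)
    (hev : χ.Even) (hord : ∃ j : ℕ, orderOf χ = p ^ j) :
    ‖ratTwistedSymbolSum f χ‖ ^ Nat.totient (p ^ (k + 1)) =
      ((p : ℝ)⁻¹) ^ ((cyclotomicOmegaMinus p (k + 1)).natDegree + lam Lflat) := by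
  obtain ⟨rfl, ⟨hgood, hap⟩, -⟩ := hX
  exact norm_ratTwistedSymbolSum_pow_totient_eq_of_lam_flat_add_le (by decide) hf hgood hap hSP
    hL0 hμL (by omega) hn χ hχ hev hord

end AllLayers

end Summit.BirchSwinnertonDyer.Rank1Residual.Supersingular

end
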